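import Literature.NumberTheory.Automorphic.AdelicGroupDataAutomorphicMeasureProofs
import Literature.NumberTheory.Automorphic.GodementCompactness
import HarnessLib

/-!
# The hermitian orbit count of `GL_N(L)` acting on a hermitian form: the class map `γ ↦ (cγ)ᵀ H γ`,
# finiteness, `GL_N(L)`-invariance, and the norm band (inputs of Borel–Harish-Chandra for `U(H)`)

Topic `NumberTheory/Automorphic`; namespace `Literature.NumberTheory.Automorphic.UnitaryGroup`.
Proof file: theorems only, no definition, no named fact, no `sorry`; imports = tree + Mathlib.

Setting: `L` a CM number field (`c` its conjugation), `H ∈ M_N(L)`, `U = U(H)(𝔸_{L⁺}) =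
adelicUnitaryGroup L H ≤ GL_N(𝔸_L)` — the stabiliser of `H_𝔸` for the right action
`X · g = (c g)ᵀ X g` (tree `Godement.conjAct`, `stabilizer_conjAct`) — and `Γ = GL_N(L)`
(`rationalPointsGL`). For the descent of finite covolume from `GL_N` to `U(H)` (Borel–Harish-Chandra
(1962) §7, §9; Godement, Sém. Bourbaki 257 §4; file `UnitaryGroupFiniteCovolume`) one counts, for
`g ∈ GL_N(𝔸_L)` and a compact `B ⊆ M_N(𝔸_L)`, the RATIONAL HERMITIAN matrices `h` with
`(cg)ᵀ h_𝔸 g ∈ B` (the «hermitian orbit set»; no definition is introduced, the set is written out).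

* `conjAct_eq_conjAct_iff` — fibres of the class map `τ γ = (cγ)ᵀ H_𝔸 γ` are the cosets `U γ`;
* `conjTranspose_mul_mul_isHermitian`, `conjAct_toAdeleGL_eq` — `(cγ)ᵀ X γ` is hermitian and is the
  class of the rational `γ`;
* `finite_hermitianOrbitSet` (tree `Godement.finite_inter_principalMatrices`),
  `encard_hermitianOrbitSet_mul_left` (left `GL_N(L)`-invariance of the count),
  `encard_image_conjAct_le` — THE ORBIT-COUNT BOUND `#τ{γ : γ g ∈ U P} ≤ #{h : (cg)ᵀ h_𝔸 g ∈ H_𝔸·P}`;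
* `glAbsDet_eq_one_of_mem_adelicUnitaryGroup` (`|det u|_𝔸 = 1`, tree `Godement.ideleNorm_det_eq_one`),
  `mem_normBand_of_mul_mem` (support in the norm band), `normBand_subset_iUnion_smul_left` (the band is
  covered by LEFT `GL_N(L)`-translates of the thickened Siegel set — tree `normBand_subset_iUnion_smul`
  plus `D⁻¹ = D`), `mem_adelicUnitaryRat_iff_mem_rationalPointsGL` (`U(H)(L⁺) = GL_N(L) ∩ U(H)(𝔸)`).

## References

* A. Borel, Harish-Chandra, *Arithmetic subgroups of algebraic groups*, Ann. of Math. 75 (1962),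
  §9 Lemma 9.4. [BorelHarishChandra1962]
* A. Borel, *Some finiteness properties of adele groups over number fields*, Publ. Math. IHÉS 16
  (1963), §5. [Borel1963]
* R. Godement, *Domaines fondamentaux des groupes arithmétiques*, Sém. Bourbaki 257, §4.
  [Godement1964]
* V. Platonov, A. Rapinchuk, *Algebraic Groups and Number Theory* (1994), §2.3, §5.3.
  [PlatonovRapinchuk1994]
-/

set_option autoImplicit false

noncomputable section

open MeasureTheory Measure NumberField IsDedekindDomain Matrix Set
open scoped MatrixGroups NNReal ENNReal Pointwise

namespace Literature.NumberTheory.Automorphic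

namespace UnitaryGroup

open Literature.Topology.Algebra

variable (L : Type) [Field L] [NumberField L] [IsCMField L] (N : ℕ) (H : Matrix (Fin N) (Fin N) L)

/-! ## §1 The class map `γ ↦ (c γ)ᵀ H γ` and the hermitian orbit count -/

/-- **Fibres of the class map are the `U`-cosets**: `(c g)ᵀ H_𝔸 g = (c g')ᵀ H_𝔸 g' ↔ g' g⁻¹ ∈ U(H)(𝔸)`
(`U(H)(𝔸)` is the stabiliser of `H_𝔸`, tree `Godement.stabilizer_conjAct`).
[cite: BorelHarishChandra1962, §9 Lemma 9.4] -/
theorem conjAct_eq_conjAct_iff (g g' : GL (Fin N) (AdeleRing (𝓞 L) L)) :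
    (Godement.conjAct L).act (H.map (algebraMap L (AdeleRing (𝓞 L) L))) g =
        (Godement.conjAct L).act (H.map (algebraMap L (AdeleRing (𝓞 L) L))) g' ↔
      g' * g⁻¹ ∈ adelicUnitaryGroup L H := by
  rw [← Godement.stabilizer_conjAct L H, RightActionData.mem_stabilizer_iff]
  constructor
  · intro h
    rw [RightActionData.act_mul, ← h, RightActionData.act_mul_inv_cancel]
  · intro h
    have : (Godement.conjAct L).act (H.map (algebraMap L (AdeleRing (𝓞 L) L))) (g' * g⁻¹ * g) =
        (Godement.conjAct L).act (H.map (algebraMap L (AdeleRing (𝓞 L) L))) g := by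
      rw [RightActionData.act_mul, h]
    rw [← this, inv_mul_cancel_right]

/-- `c ∘ c = id` on matrices over the CM field (private plumbing). [folklore] -/
private theorem map_cmConjRingHom_map_cmConjRingHom {m n : Type*} (A : Matrix m n L) :
    (A.map (cmConjRingHom L)).map (cmConjRingHom L) = A := by
  ext i j
  simp only [Matrix.map_apply, cmConjRingHom_apply, IsCMField.complexConj_apply_apply]

variable {L N} in
/-- **`γ^* X γ` is hermitian when `X` is**: `(c((cγ)ᵀ X γ))ᵀ = (cγ)ᵀ X γ`.
[cite: PlatonovRapinchuk1994, §2.3] -/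
theorem conjTranspose_mul_mul_isHermitian {X : Matrix (Fin N) (Fin N) L}
    (hX : (X.map (cmConjRingHom L))ᵀ = X) (g : Matrix (Fin N) (Fin N) L) :
    ((((g.map (cmConjRingHom L))ᵀ * X * g).map (cmConjRingHom L)))ᵀ =
      (g.map (cmConjRingHom L))ᵀ * X * g := by
  rw [Matrix.map_mul, Matrix.map_mul, ← Matrix.transpose_map, map_cmConjRingHom_map_cmConjRingHom,
    Matrix.transpose_mul, Matrix.transpose_mul, Matrix.transpose_transpose, Matrix.transpose_map, hX,
    Matrix.mul_assoc]

/-- **The class of a rational `γ` is the base change of the rational matrix `(cγ)ᵀ X γ`**: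
`(c γ_𝔸)ᵀ X_𝔸 γ_𝔸 = ((cγ)ᵀ X γ)_𝔸` for any `X ∈ M_N(L)`. [folklore]
[cite: Godement1964, §4] -/
theorem conjAct_toAdeleGL_eq (X : Matrix (Fin N) (Fin N) L) (g : GL (Fin N) L) :
    (Godement.conjAct L).act (X.map (algebraMap L (AdeleRing (𝓞 L) L))) (toAdeleGL L g) =
      (((g : Matrix (Fin N) (Fin N) L).map (cmConjRingHom L))ᵀ * X *
        (g : Matrix (Fin N) (Fin N) L)).map (algebraMap L (AdeleRing (𝓞 L) L)) := by
  rw [Godement.conjAct_act, val_toAdeleGL, Godement.map_map_adeleConj, ← Matrix.transpose_map,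
    ← Matrix.map_mul, ← Matrix.map_mul]

/-- **The hermitian orbit set is finite**: for compact `B ⊆ M_N(𝔸_L)` and any `g`, the rational
matrices `h` with `(c g)ᵀ h_𝔸 g ∈ B` form a finite set (`h_𝔸` lies in the compact `B · g⁻¹` and is
principal; tree `Godement.finite_inter_principalMatrices`). [cite: Godement1964, §4] -/
theorem finite_hermitianOrbitSet {B : Set (Matrix (Fin N) (Fin N) (AdeleRing (𝓞 L) L))}
    (hB : IsCompact B) (g : GL (Fin N) (AdeleRing (𝓞 L) L)) :
    {h : Matrix (Fin N) (Fin N) L | (h.map (cmConjRingHom L))ᵀ = h ∧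
      (Godement.conjAct L).act (h.map (algebraMap L (AdeleRing (𝓞 L) L))) g ∈ B}.Finite := by
  haveI : Nontrivial (AdeleRing (𝓞 L) L) :=
    inferInstanceAs (Nontrivial (InfiniteAdeleRing L × FiniteAdeleRing (𝓞 L) L))
  -- the compact set `B · g⁻¹` of adelic matrices whose `g`-translate lies in `B`
  have hCc : IsCompact ((fun X => (Godement.conjAct L).act X g⁻¹) '' B) := by
    refine hB.image ?_
    simp only [Godement.conjAct_act]
    exact (continuous_const.matrix_mul continuous_id).matrix_mul continuous_const
  have hfin := Godement.finite_inter_principalMatrices L (n := Fin N) hCc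
  -- `h ↦ h_𝔸` is injective and maps our set into `(B · g⁻¹) ∩ M_N(L)`
  refine Set.Finite.of_finite_image (hfin.subset ?_)
    (Matrix.map_injective (algebraMap L (AdeleRing (𝓞 L) L)).injective).injOn
  rintro _ ⟨h, ⟨-, hh⟩, rfl⟩
  refine ⟨⟨(Godement.conjAct L).act (h.map (algebraMap L (AdeleRing (𝓞 L) L))) g, hh, ?_⟩,
    fun i j => ⟨h i j, rfl⟩⟩
  exact RightActionData.act_mul_inv_cancel _ _ _

variable {L N H} in
/-- **The orbit-count bound.** For `γ ∈ GL_N(L)` with `γ g ∈ U(H)(𝔸) · P`, the class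
`τ γ = (cγ)ᵀ H_𝔸 γ` is the base change of the rational HERMITIAN matrix `h = (cγ)ᵀ H γ`, and
`(cg)ᵀ h_𝔸 g = (c(γg))ᵀ H_𝔸 (γ g) = (cp)ᵀ H_𝔸 p` for the `P`-component `p` of `γ g = u p`. Hence
`#τ{γ ∈ Γ : γ g ∈ U P} ≤ #{h ∈ M_N(L) hermitian : (cg)ᵀ h_𝔸 g ∈ H_𝔸 · P}` — the count of the
`Γ`-orbit of `H` meeting a compact piece, as in Borel–Harish-Chandra's and Godement's descent.
[cite: BorelHarishChandra1962, §9 Lemma 9.4] [cite: Godement1964, §4] -/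
theorem encard_image_conjAct_le (hH : (H.map (cmConjRingHom L))ᵀ = H)
    (P : Set (GL (Fin N) (AdeleRing (𝓞 L) L))) (g : GL (Fin N) (AdeleRing (𝓞 L) L)) :
    ((fun γ : rationalPointsGL N L =>
        (Godement.conjAct L).act (H.map (algebraMap L (AdeleRing (𝓞 L) L)))
          (γ : GL (Fin N) (AdeleRing (𝓞 L) L))) ''
        {γ : rationalPointsGL N L | (γ : GL (Fin N) (AdeleRing (𝓞 L) L)) * g ∈
          (adelicUnitaryGroup L H : Set (GL (Fin N) (AdeleRing (𝓞 L) L))) * P}).encard ≤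
      {h : Matrix (Fin N) (Fin N) L | (h.map (cmConjRingHom L))ᵀ = h ∧
        (Godement.conjAct L).act (h.map (algebraMap L (AdeleRing (𝓞 L) L))) g ∈
          (fun p : GL (Fin N) (AdeleRing (𝓞 L) L) =>
            (Godement.conjAct L).act (H.map (algebraMap L (AdeleRing (𝓞 L) L))) p) '' P}.encard := by
  -- the image is contained in the base change of the hermitian orbit set
  have hsub : ((fun γ : rationalPointsGL N L =>
        (Godement.conjAct L).act (H.map (algebraMap L (AdeleRing (𝓞 L) L)))
          (γ : GL (Fin N) (AdeleRing (𝓞 L) L))) ''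
        {γ : rationalPointsGL N L | (γ : GL (Fin N) (AdeleRing (𝓞 L) L)) * g ∈
          (adelicUnitaryGroup L H : Set (GL (Fin N) (AdeleRing (𝓞 L) L))) * P}) ⊆
      (fun h : Matrix (Fin N) (Fin N) L => h.map (algebraMap L (AdeleRing (𝓞 L) L))) ''
        {h : Matrix (Fin N) (Fin N) L | (h.map (cmConjRingHom L))ᵀ = h ∧
          (Godement.conjAct L).act (h.map (algebraMap L (AdeleRing (𝓞 L) L))) g ∈
            (fun p : GL (Fin N) (AdeleRing (𝓞 L) L) =>
              (Godement.conjAct L).act (H.map (algebraMap L (AdeleRing (𝓞 L) L))) p) '' P} := by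
    rintro _ ⟨γ, hγ, rfl⟩
    obtain ⟨g₀, hg₀⟩ := MonoidHom.mem_range.1 γ.2
    have hg₀' : toAdeleGL L g₀ = (γ : GL (Fin N) (AdeleRing (𝓞 L) L)) := hg₀
    obtain ⟨u, hu, p, hp, hup⟩ := Set.mem_mul.1 hγ
    have hstab : (Godement.conjAct L).act (H.map (algebraMap L (AdeleRing (𝓞 L) L))) u =
        H.map (algebraMap L (AdeleRing (𝓞 L) L)) := (mem_adelicUnitaryGroup_iff L H u).1 hu
    refine ⟨((g₀ : Matrix (Fin N) (Fin N) L).map (cmConjRingHom L))ᵀ * H *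
      (g₀ : Matrix (Fin N) (Fin N) L), ⟨conjTranspose_mul_mul_isHermitian hH _, ?_⟩, ?_⟩
    · -- `(cg)ᵀ h_𝔸 g = H_𝔸 · (γ g) = H_𝔸 · (u p) = H_𝔸 · p`
      refine ⟨p, hp, ?_⟩
      show (Godement.conjAct L).act (H.map (algebraMap L (AdeleRing (𝓞 L) L))) p =
        (Godement.conjAct L).act ((((g₀ : Matrix (Fin N) (Fin N) L).map (cmConjRingHom L))ᵀ * H *
          (g₀ : Matrix (Fin N) (Fin N) L)).map (algebraMap L (AdeleRing (𝓞 L) L))) g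
      rw [← conjAct_toAdeleGL_eq L N H g₀, ← RightActionData.act_mul, hg₀', ← hup,
        RightActionData.act_mul, hstab]
    · show (((g₀ : Matrix (Fin N) (Fin N) L).map (cmConjRingHom L))ᵀ * H *
          (g₀ : Matrix (Fin N) (Fin N) L)).map (algebraMap L (AdeleRing (𝓞 L) L)) =
        (Godement.conjAct L).act (H.map (algebraMap L (AdeleRing (𝓞 L) L)))
          (γ : GL (Fin N) (AdeleRing (𝓞 L) L))
      rw [← hg₀', conjAct_toAdeleGL_eq]
  haveI : Nontrivial (AdeleRing (𝓞 L) L) :=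
    inferInstanceAs (Nontrivial (InfiniteAdeleRing L × FiniteAdeleRing (𝓞 L) L))
  calc _ ≤ _ := Set.encard_le_encard hsub
    _ = _ := (Matrix.map_injective (algebraMap L (AdeleRing (𝓞 L) L)).injective).injOn.encard_image

variable {L N} in
/-- **`|det u|_𝔸 = 1` on `U(H)(𝔸)`** in the currency `glAbsDet` of the `GL_N` reduction theory
(tree `Godement.ideleNorm_det_eq_one`). [cite: Godement1964, §4] -/
theorem glAbsDet_eq_one_of_mem_adelicUnitaryGroup (hdet : H.det ≠ 0)
    {u : GL (Fin N) (AdeleRing (𝓞 L) L)} (hu : u ∈ adelicUnitaryGroup L H) :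
    glAbsDet N L u = 1 := by
  refine Units.ext (NNReal.eq ?_)
  change ((IdeleClassGroup.ideleNorm L (Matrix.GeneralLinearGroup.det u) : ℝ≥0) : ℝ) = _
  rw [Godement.ideleNorm_det_eq_one L H hdet hu]
  rfl

variable {L N H} in
/-- **Support in the norm band**: if `γ g ∈ U(H)(𝔸) · P` with `γ` rational and `P` inside the norm band
`{1/2 ≤ |det| ≤ 2}`, then `g` lies in the norm band (`|det γ| = |det u| = 1`).
[cite: Borel1963, §5] -/
theorem mem_normBand_of_mul_mem (hdet : H.det ≠ 0) {P : Set (GL (Fin N) (AdeleRing (𝓞 L) L))}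
    (hP : P ⊆ normBand N L) {γ g : GL (Fin N) (AdeleRing (𝓞 L) L)} (hγ : γ ∈ rationalPointsGL N L)
    (h : γ * g ∈ (adelicUnitaryGroup L H : Set (GL (Fin N) (AdeleRing (𝓞 L) L))) * P) :
    g ∈ normBand N L := by
  obtain ⟨u, hu, p, hp, hup⟩ := Set.mem_mul.1 h
  have hg : glAbsDet N L g = glAbsDet N L p := by
    have h1 : glAbsDet N L (γ * g) = glAbsDet N L (u * p) := by rw [hup]
    rw [map_mul, map_mul, glAbsDet_eq_one_of_mem_rationalPointsGL hγ,
      glAbsDet_eq_one_of_mem_adelicUnitaryGroup H hdet hu, one_mul, one_mul] at h1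
    exact h1
  have := hP hp
  rw [mem_normBand_iff] at this ⊢
  rw [hg]
  exact this

variable {L N} in
/-- **Left `Γ`-invariance of the hermitian orbit count**: for rational `γ = γ₀,𝔸`, the bijection
`h ↦ (cγ₀)ᵀ h γ₀` of the hermitian rational matrices carries `{h : (c(γg))ᵀ h_𝔸 (γg) ∈ B}` onto
`{h : (cg)ᵀ h_𝔸 g ∈ B}`, so the counts agree. [cite: Godement1964, §4] -/
theorem encard_hermitianOrbitSet_mul_left (B : Set (Matrix (Fin N) (Fin N) (AdeleRing (𝓞 L) L)))
    {γ : GL (Fin N) (AdeleRing (𝓞 L) L)} (hγ : γ ∈ rationalPointsGL N L)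
    (g : GL (Fin N) (AdeleRing (𝓞 L) L)) :
    {h : Matrix (Fin N) (Fin N) L | (h.map (cmConjRingHom L))ᵀ = h ∧
        (Godement.conjAct L).act (h.map (algebraMap L (AdeleRing (𝓞 L) L))) (γ * g) ∈ B}.encard =
      {h : Matrix (Fin N) (Fin N) L | (h.map (cmConjRingHom L))ᵀ = h ∧
        (Godement.conjAct L).act (h.map (algebraMap L (AdeleRing (𝓞 L) L))) g ∈ B}.encard := by
  obtain ⟨g₀, rfl⟩ := MonoidHom.mem_range.1 hγ
  -- the rational conjugation action `h ↦ (c g₀)ᵀ h g₀` as a bijection of `M_N(L)`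
  let φ : Matrix (Fin N) (Fin N) L → Matrix (Fin N) (Fin N) L := fun h =>
    ((g₀ : Matrix (Fin N) (Fin N) L).map (cmConjRingHom L))ᵀ * h * (g₀ : Matrix (Fin N) (Fin N) L)
  let ψ : Matrix (Fin N) (Fin N) L → Matrix (Fin N) (Fin N) L := fun h =>
    (((g₀⁻¹ : GL (Fin N) L) : Matrix (Fin N) (Fin N) L).map (cmConjRingHom L))ᵀ * h *
      ((g₀⁻¹ : GL (Fin N) L) : Matrix (Fin N) (Fin N) L)
  have hc_mul : ∀ (a b : GL (Fin N) L),
      ((a : Matrix (Fin N) (Fin N) L).map (cmConjRingHom L)) *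
        ((b : Matrix (Fin N) (Fin N) L).map (cmConjRingHom L)) =
      ((a * b : GL (Fin N) L) : Matrix (Fin N) (Fin N) L).map (cmConjRingHom L) := fun a b => by
    rw [Units.val_mul, Matrix.map_mul]
  have hψφ : ∀ h, ψ (φ h) = h := by
    intro h
    simp only [φ, ψ]
    have e1 : (((g₀⁻¹ : GL (Fin N) L) : Matrix (Fin N) (Fin N) L).map (cmConjRingHom L))ᵀ *
        (((g₀ : Matrix (Fin N) (Fin N) L).map (cmConjRingHom L))ᵀ) = 1 := by
      rw [← Matrix.transpose_mul, hc_mul, mul_inv_cancel, Units.val_one,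
        Matrix.map_one _ (map_zero _) (map_one _), Matrix.transpose_one]
    have e2 : (g₀ : Matrix (Fin N) (Fin N) L) * ((g₀⁻¹ : GL (Fin N) L) : Matrix (Fin N) (Fin N) L) = 1 := by
      rw [← Units.val_mul, mul_inv_cancel, Units.val_one]
    calc _ = ((((g₀⁻¹ : GL (Fin N) L) : Matrix (Fin N) (Fin N) L).map (cmConjRingHom L))ᵀ *
          ((g₀ : Matrix (Fin N) (Fin N) L).map (cmConjRingHom L))ᵀ) * h *
          ((g₀ : Matrix (Fin N) (Fin N) L) * ((g₀⁻¹ : GL (Fin N) L) : Matrix (Fin N) (Fin N) L)) := by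
            simp only [Matrix.mul_assoc]
      _ = h := by rw [e1, e2, Matrix.one_mul, Matrix.mul_one]
  have hφψ : ∀ h, φ (ψ h) = h := by
    intro h
    simp only [φ, ψ]
    have e1 : (((g₀ : Matrix (Fin N) (Fin N) L)).map (cmConjRingHom L))ᵀ *
        ((((g₀⁻¹ : GL (Fin N) L) : Matrix (Fin N) (Fin N) L).map (cmConjRingHom L))ᵀ) = 1 := by
      rw [← Matrix.transpose_mul, hc_mul, inv_mul_cancel, Units.val_one,
        Matrix.map_one _ (map_zero _) (map_one _), Matrix.transpose_one]
    have e2 : ((g₀⁻¹ : GL (Fin N) L) : Matrix (Fin N) (Fin N) L) * (g₀ : Matrix (Fin N) (Fin N) L) = 1 := by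
      rw [← Units.val_mul, inv_mul_cancel, Units.val_one]
    calc _ = ((((g₀ : Matrix (Fin N) (Fin N) L)).map (cmConjRingHom L))ᵀ *
          (((g₀⁻¹ : GL (Fin N) L) : Matrix (Fin N) (Fin N) L).map (cmConjRingHom L))ᵀ) * h *
          (((g₀⁻¹ : GL (Fin N) L) : Matrix (Fin N) (Fin N) L) * (g₀ : Matrix (Fin N) (Fin N) L)) := by
            simp only [Matrix.mul_assoc]
      _ = h := by rw [e1, e2, Matrix.one_mul, Matrix.mul_one]
  let e : Matrix (Fin N) (Fin N) L ≃ Matrix (Fin N) (Fin N) L := ⟨φ, ψ, hψφ, hφψ⟩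
  -- hermitian-ness is preserved both ways
  have hherm : ∀ h : Matrix (Fin N) (Fin N) L, (h.map (cmConjRingHom L))ᵀ = h ↔
      ((φ h).map (cmConjRingHom L))ᵀ = φ h := by
    intro h
    constructor
    · intro hh
      exact conjTranspose_mul_mul_isHermitian hh _
    · intro hh
      have := conjTranspose_mul_mul_isHermitian hh ((g₀⁻¹ : GL (Fin N) L) : Matrix (Fin N) (Fin N) L)
      change ((ψ (φ h)).map (cmConjRingHom L))ᵀ = ψ (φ h) at this
      rwa [hψφ] at this
  -- the action intertwines: `(c(γ g))ᵀ h_𝔸 (γ g) = (cg)ᵀ (φ h)_𝔸 g`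
  have hact : ∀ h : Matrix (Fin N) (Fin N) L,
      (Godement.conjAct L).act (h.map (algebraMap L (AdeleRing (𝓞 L) L)))
          (Matrix.GeneralLinearGroup.map (algebraMap L (AdeleRing (𝓞 L) L)) g₀ * g) =
        (Godement.conjAct L).act ((φ h).map (algebraMap L (AdeleRing (𝓞 L) L))) g := by
    intro h
    rw [RightActionData.act_mul]
    change (Godement.conjAct L).act ((Godement.conjAct L).act _ (toAdeleGL L g₀)) g = _
    rw [conjAct_toAdeleGL_eq]
  have hset : {h : Matrix (Fin N) (Fin N) L | (h.map (cmConjRingHom L))ᵀ = h ∧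
        (Godement.conjAct L).act (h.map (algebraMap L (AdeleRing (𝓞 L) L)))
          (Matrix.GeneralLinearGroup.map (algebraMap L (AdeleRing (𝓞 L) L)) g₀ * g) ∈ B} =
      e ⁻¹' {h : Matrix (Fin N) (Fin N) L | (h.map (cmConjRingHom L))ᵀ = h ∧
        (Godement.conjAct L).act (h.map (algebraMap L (AdeleRing (𝓞 L) L))) g ∈ B} := by
    ext h
    simp only [Set.mem_setOf_eq, Set.mem_preimage]
    rw [hherm h, hact h]
    rfl
  rw [hset]
  exact Set.encard_preimage_of_bijective e.bijective _

omit [IsCMField L] in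
/-- **The norm band is covered by LEFT `Γ`-translates of the thickened Siegel set**: from the tree's
`normBand_subset_iUnion_smul` (`D ⊆ ⋃_γ (Z Ω A_t K)⁻¹ γ`) and `D⁻¹ = D`:
`D ⊆ ⋃_γ γ · (Z Ω A_t K)`. [cite: Borel1963, §5 Thm. 5.8] -/
theorem normBand_subset_iUnion_smul_left :
    ∃ (Ω : Set (GL (Fin N) (AdeleRing (𝓞 L) L))) (t : ℝ) (Z : Set (GL (Fin N) (AdeleRing (𝓞 L) L))),
      0 < t ∧ IsCompact Ω ∧
      Ω ⊆ (standardParabolicGL (AdeleRing (𝓞 L) L) (id : Fin N → Fin N) :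
        Set (GL (Fin N) (AdeleRing (𝓞 L) L))) ∧
      IsCompact Z ∧ Z ⊆ Set.range (posRealScalar N L) ∧
      normBand N L ⊆ ⋃ γ : rationalPointsGL N L,
        γ • (Z * (Ω * siegelCone N L t *
          (standardMaximalCompactGL N L : Set (GL (Fin N) (AdeleRing (𝓞 L) L))))) := by
  obtain ⟨Ω, t, Z, ht, hΩc, hΩB, hZc, hZr, hDsub⟩ := normBand_subset_iUnion_smul N L
  refine ⟨Ω, t, Z, ht, hΩc, hΩB, hZc, hZr, fun g hg => ?_⟩
  -- `g⁻¹ ∈ D ⊆ ⋃_γ S⁻¹ γ`, so `g⁻¹ = s⁻¹ γ` and `g = γ⁻¹ s`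
  have hginv : g⁻¹ ∈ normBand N L := by
    rw [mem_normBand_iff] at hg ⊢
    have hpos : (0 : ℝ) < ((glAbsDet N L g : ℝ≥0) : ℝ) :=
      NNReal.coe_pos.2 (pos_iff_ne_zero.2 (glAbsDet N L g).ne_zero)
    have hinv : (((glAbsDet N L g⁻¹ : ℝ≥0ˣ) : ℝ≥0) : ℝ) = (((glAbsDet N L g : ℝ≥0ˣ) : ℝ≥0) : ℝ)⁻¹ := by
      rw [map_inv, Units.val_inv_eq_inv_val, NNReal.coe_inv]
    rw [hinv]
    constructor
    · rw [le_inv_comm₀ (by norm_num) hpos]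
      linarith [hg.2]
    · rw [inv_le_comm₀ hpos (by norm_num)]
      linarith [hg.1]
  obtain ⟨γ, hγ⟩ := Set.mem_iUnion.1 (hDsub hginv)
  rw [Set.mem_smul_set_iff_inv_smul_mem, Subgroup.smul_def, MulOpposite.smul_eq_mul_unop] at hγ
  -- `γ⁻¹ • g⁻¹ = g⁻¹ · γ⁻¹ ∈ S⁻¹`, i.e. `γ g ∈ S`
  have hmem : (MulOpposite.unop ((γ : (GL (Fin N) (AdeleRing (𝓞 L) L))ᵐᵒᵖ))) * g ∈
      Z * (Ω * siegelCone N L t *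
        (standardMaximalCompactGL N L : Set (GL (Fin N) (AdeleRing (𝓞 L) L)))) := by
    have := Set.mem_inv.1 hγ
    simpa only [_root_.mul_inv_rev, inv_inv, Subgroup.coe_inv, MulOpposite.unop_inv] using this
  have hγΓ : MulOpposite.unop ((γ : (GL (Fin N) (AdeleRing (𝓞 L) L))ᵐᵒᵖ)) ∈ rationalPointsGL N L :=
    Subgroup.mem_op.1 γ.2
  refine Set.mem_iUnion.2 ⟨⟨(MulOpposite.unop ((γ : (GL (Fin N) (AdeleRing (𝓞 L) L))ᵐᵒᵖ)))⁻¹,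
    (rationalPointsGL N L).inv_mem hγΓ⟩, ?_⟩
  rw [Set.mem_smul_set_iff_inv_smul_mem, Subgroup.smul_def, smul_eq_mul]
  simpa only [Subgroup.coe_inv, inv_inv] using hmem

/-- `U(H)(L⁺) = GL_N(L) ∩ U(H)(𝔸)` inside `U(H)(𝔸)`: a point of the adelic unitary group is in
`adelicUnitaryRat` iff its matrix is rational (tree `Godement.mem_adelicUnitaryRat_of_eq_toAdeleGL`).
[folklore] [cite: Godement1964, §4] -/
theorem mem_adelicUnitaryRat_iff_mem_rationalPointsGL (u : adelicUnitaryGroup L H) :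
    u ∈ adelicUnitaryRat L H ↔ (u : GL (Fin N) (AdeleRing (𝓞 L) L)) ∈ rationalPointsGL N L := by
  constructor
  · intro hu
    obtain ⟨g, -, hg⟩ := (mem_adelicUnitaryRat_iff L H u).1 hu
    exact ⟨g, hg⟩
  · rintro ⟨g, hg⟩
    have := Godement.mem_adelicUnitaryRat_of_eq_toAdeleGL L H u.2 (g := g) hg
    exact this

end UnitaryGroup

end Literature.NumberTheory.Automorphic

end
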